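import Literature.AlgebraicGeometry.Modules.SerreTwistHom
import Literature.AlgebraicGeometry.Modules.SerreTwistTrivial
import Literature.AlgebraicGeometry.Modules.SheafHomLeft
import Literature.AlgebraicGeometry.Modules.AffineLocalizing
import Literature.AlgebraicGeometry.KTheory.GrothendieckGroup
import Mathlib.Topology.Sheaves.LocallySurjective
import Mathlib.AlgebraicGeometry.AffineScheme
import HarnessLib

/-!
# Finite direct sums `𝒪_Z(-m)^{⊕(N+1)}` of Serre's twisting sheaf and the evaluation morphism to a module

For `ι : Z ⟶ 𝐏ʳ_A`, an `𝒪_Z`-module `G` and global sections `g_j ∈ Γ(Z, G(m))` (`j ≤ N`), this file packages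
the standard consequence of Serre's theorems A and B (Hartshorne II Cor. 5.18, III Thm. 5.2): the vector bundle
`L_N = 𝒪_Z(-m) ⊞ ⋯ ⊞ 𝒪_Z(-m)` (`SerreTwist.Lpow`, iterated binary biproducts; finite locally free,
`isFiniteLocallyFree_Lpow`), the morphism `L_N → G` summing the morphisms of the `g_j`
(`SerreTwist.piPow`, `Modules/SerreTwistHom.homOfTwistSection`; injections `injPow`, `injPow_piPow`), and

* `SerreTwist.epi_piPow` — **`L_N → G` is an epimorphism** when `G` is affine-localizing and the chart values
  `(g_j)_i` generate `Γ(Z_i, G)` for every `i` (locally surjective on the basic opens of the affine charts,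
  `epi_of_locallySurjective`);
* `SerreTwist.subsingleton_cechMH1_sheafHom_Lpow` — **`Ȟ¹(𝒰; 𝓗om(L_N, G)) = 0` as soon as
  `Ȟ¹(𝒰; G(m)) = 0`** (`𝓗om(𝒪(-m), G) ≅ G(m)`, `Modules/SerreTwistHom.sheafHomTwistIso`, and additivity over
  biproducts, `Modules/SheafHomLeft`).

Everything is proved; no named facts.

References: Hartshorne II Cor. 5.18, III Thm. 5.2. [Hartshorne1977]
-/

noncomputable section

universe u

open CategoryTheory CategoryTheory.Limits AlgebraicGeometry TopologicalSpace Opposite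
open Literature.Algebra.Homology Literature.Algebra.Homology.LaurentCech
open Literature.AlgebraicGeometry.Morphisms Literature.AlgebraicGeometry.Morphisms.ProjCech
open Literature.AlgebraicGeometry.Motives Literature.AlgebraicGeometry.KTheory

attribute [local instance] MvPolynomial.gradedAlgebra
  Literature.AlgebraicGeometry.Motives.ProjBaseChange.algebraBase

namespace Literature.AlgebraicGeometry.Modules

namespace SerreTwist

/-! ## Generalities: a local-surjectivity criterion for epimorphisms; `Ȟ¹` along isomorphisms -/

section General

variable {X : Scheme.{u}} {M N : X.Modules}

/-- A morphism of `𝒪_X`-modules which is locally surjective on sections (every section of the target is,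
near every point, the image of a section of the source) is an epimorphism (Mathlib
`TopCat.Presheaf.isLocallySurjective_iff_epi` for the underlying sheaves of groups). [folklore] -/
theorem epi_of_locallySurjective (φ : M ⟶ N)
    (h : ∀ (U : X.Opens) (t : Γ(N, U)) (x : X), x ∈ U →
      ∃ (V : X.Opens) (_ : V ≤ U), x ∈ V ∧ ∃ s : Γ(M, V), φ.app V s = N.presheaf.map (homOfLE ‹V ≤ U›).op t) :
    Epi φ := by
  have hls : TopCat.Presheaf.IsLocallySurjective φ.mapPresheaf := by
    rw [TopCat.Presheaf.isLocallySurjective_iff]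
    intro U t x hx
    obtain ⟨V, hVU, hxV, s, hs⟩ := h U t x hx
    exact ⟨V, hVU, ⟨s, hs⟩, hxV⟩
  have h1 : Epi ((SheafOfModules.toSheaf X.ringCatSheaf).map φ) :=
    (TopCat.Sheaf.isLocallySurjective_iff_epi _).mp hls
  have h2 := (SheafOfModules.toSheaf X.ringCatSheaf).epi_of_epi_map h1
  exact ⟨fun _ _ hh => (@cancel_epi _ _ _ _ _ _ h2 _ _).mp hh⟩

end General

/-! ## The direct sum `𝒪_Z(-m)^{⊕(N+1)}` and the morphism to `G` -/

section Sum

variable {A : Type u} [CommRing A] {r : ℕ} {Z : Scheme.{u}} (ι : Z ⟶ PP A r) (G : Z.Modules) (m : ℕ)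
  (g : ℕ → Γ(twistMod ι G m, ⊤))

/-- `L_N = 𝒪_Z(-m) ⊞ (𝒪_Z(-m) ⊞ ⋯)` with `N + 1` summands. [folklore] -/
def Lpow : ℕ → Z.Modules
  | 0 => serreTwist ι m
  | N + 1 => serreTwist ι m ⊞ Lpow N

/-- `L_N` is finite locally free. [folklore] -/
theorem isFiniteLocallyFree_Lpow : ∀ N, IsFiniteLocallyFree (Lpow ι m N)
  | 0 => isFiniteLocallyFree_serreTwist ι m
  | N + 1 => KZero.isFiniteLocallyFree_biprod (isFiniteLocallyFree_serreTwist ι m) (isFiniteLocallyFree_Lpow N)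

/-- The morphism `L_N → G`, `(f_0, …, f_N) ↦ Σ_j (morphism of g_j)(f_j)`. [folklore] -/
def piPow : ∀ N, Lpow ι m N ⟶ G
  | 0 => homOfTwistSection ι G m (g 0)
  | N + 1 => biprod.desc (homOfTwistSection ι G m (g (N + 1))) (piPow N)

/-- The `j`-th injection `𝒪_Z(-m) → L_N` (zero for `j > N`). [folklore] -/
def injPow (j : ℕ) : ∀ N, serreTwist ι m ⟶ Lpow ι m N
  | 0 => if j = 0 then 𝟙 _ else 0
  | N + 1 => if j = N + 1 then biprod.inl else injPow j N ≫ biprod.inr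

/-- The `j`-th injection followed by `L_N → G` is the morphism of `g_j` (`j ≤ N`). [folklore] -/
theorem injPow_piPow (j : ℕ) : ∀ N, j ≤ N → injPow ι m j N ≫ piPow ι G m g N = homOfTwistSection ι G m (g j)
  | 0, hj => by
    obtain rfl : j = 0 := Nat.le_zero.mp hj
    rw [show injPow ι m 0 0 = 𝟙 _ from if_pos rfl]
    exact Category.id_comp _
  | N + 1, hj => by
    by_cases h : j = N + 1
    · subst h
      rw [show injPow ι m (N + 1) (N + 1) = biprod.inl from if_pos rfl]
      exact biprod.inl_desc _ _
    · rw [show injPow ι m j (N + 1) = injPow ι m j N ≫ biprod.inr from if_neg h]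
      calc (injPow ι m j N ≫ biprod.inr) ≫ piPow ι G m g (N + 1)
          = injPow ι m j N ≫ (biprod.inr ≫ biprod.desc (homOfTwistSection ι G m (g (N + 1))) (piPow ι G m g N)) :=
            Category.assoc _ _ _
        _ = injPow ι m j N ≫ piPow ι G m g N := by rw [biprod.inr_desc]
        _ = _ := injPow_piPow j N (by omega)

variable {A' : Type u} [CommRing A'] (f : Z ⟶ Spec (.of A')) {κ : Type} (U : κ → Z.Opens)

/-- `Ȟ¹(𝒰; 𝓗om(L_N, G))` vanishes as soon as `Ȟ¹(𝒰; G(m))` does (`𝓗om(𝒪(-m), G) ≅ G(m)` and additivity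
over the biproduct). [folklore] -/
theorem subsingleton_cechMH1_sheafHom_Lpow (h : Subsingleton (CechMH1 f (twistMod ι G m) U)) :
    ∀ N, Subsingleton (CechMH1 f (sheafHom (Lpow ι m N) G) U)
  | 0 => subsingleton_cechMH1_of_iso f U (sheafHomTwistIso ι G m) h
  | N + 1 => subsingleton_cechMH1_sheafHom_biprod f U (serreTwist ι m) (Lpow ι m N) G
      (subsingleton_cechMH1_of_iso f U (sheafHomTwistIso ι G m) h) (subsingleton_cechMH1_sheafHom_Lpow h N)

/-! ### The morphism `L_N → G` is an epimorphism when the `g_j` generate -/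

/-- The section `c · v_i|_V` of `𝒪_Z(-m)` over `V ⊆ Z_i` goes to `c · (g_j)_i|_V` under the morphism of
`g_j`. [folklore] -/
theorem homOfTwistSection_app_smul_gen (j : ℕ) {i : Fin (r + 1)} {V : Z.Opens} (hV : V ≤ Zop ι {i})
    (c : Γ(Z, V)) :
    (homOfTwistSection ι G m (g j)).app V (c • (serreTwist ι m).presheaf.map (homOfLE hV).op (gen ι m i)) =
      c • G.presheaf.map (homOfLE (le_inf le_top hV : V ≤ ⊤ ⊓ Zop ι {i})).op (comp ι G (g j) i) := by
  rw [homOfTwistSection_app ι G m (g j) hV, coeff_smul_map_gen_const]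

variable [IsAffineHom ι]

/-- **`L_N → G` is an epimorphism** when `G` is affine-localizing and the chart values `(g_j)_i`,
`j ≤ N`, generate `Γ(G, Z_i)` over `Γ(Z, Z_i)` for every `i`: on a basic open `D(h) ⊆ Z_i`, every
section of `G` is `h^{-M} Σ_j a_j (g_j)_i`. [folklore] -/
theorem epi_piPow (hloc : IsAffineLocalizing G) (N : ℕ)
    (hgen : ∀ (i : Fin (r + 1)) (t : Γ(G, Zop ι {i})),
      t ∈ Submodule.span Γ(Z, Zop ι {i}) (Set.range fun j : Fin (N + 1) =>
        G.presheaf.map (homOfLE (le_inf le_top le_rfl : Zop ι {i} ≤ ⊤ ⊓ Zop ι {i})).op (comp ι G (g j) i))) :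
    Epi (piPow ι G m g N) := by
  classical
  refine epi_of_locallySurjective _ fun U t x hx => ?_
  -- a chart `Z_i ∋ x` and a basic open `x ∈ D(h) ⊆ U ∩ Z_i` of the affine `Z_i`
  have hxtop : x ∈ (⊤ : Z.Opens) := trivial
  rw [← iSup_cover_eq_top ι] at hxtop
  obtain ⟨i, hxi⟩ := Opens.mem_iSup.mp hxtop
  have hU : IsAffineOpen (Zop ι {i}) := isAffineOpen_cover ι i
  obtain ⟨h, hhU, hxh⟩ := hU.exists_basicOpen_le (V := U ⊓ Zop ι {i}) ⟨x, ⟨hx, hxi⟩⟩ hxi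
  have hDi : Z.basicOpen h ≤ Zop ι {i} := Z.basicOpen_le h
  have hDU : Z.basicOpen h ≤ U := hhU.trans inf_le_left
  -- numerator: `h^M t|_{D(h)}` extends to `y ∈ Γ(G, Z_i)`, a combination of the `(g_j)_i`
  obtain ⟨M, y, hy⟩ := hloc.numerator hU h rfl (G.presheaf.map (homOfLE hDU).op t)
  obtain ⟨a, ha⟩ := (Submodule.mem_span_range_iff_exists_fun _).mp (hgen i y)
  -- `h|_{D(h)}` is a unit
  obtain ⟨u, hu⟩ : IsUnit (Z.presheaf.map (homOfLE (Z.basicOpen_le h)).op h) := Z.toRingedSpace.isUnit_res_basicOpen h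
  refine ⟨Z.basicOpen h, hDU, hxh, ∑ j : Fin (N + 1), (injPow ι m j N).app _
    (((↑(u⁻¹ ^ M) : Γ(Z, Z.basicOpen h)) * Z.presheaf.map (homOfLE hDi).op (a j)) •
      (serreTwist ι m).presheaf.map (homOfLE hDi).op (gen ι m i)), ?_⟩
  rw [map_sum]
  have hterm : ∀ j : Fin (N + 1), (piPow ι G m g N).app _ ((injPow ι m j N).app _
      (((↑(u⁻¹ ^ M) : Γ(Z, Z.basicOpen h)) * Z.presheaf.map (homOfLE hDi).op (a j)) •
        (serreTwist ι m).presheaf.map (homOfLE hDi).op (gen ι m i))) =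
      ((↑(u⁻¹ ^ M) : Γ(Z, Z.basicOpen h)) * Z.presheaf.map (homOfLE hDi).op (a j)) •
        G.presheaf.map (homOfLE (le_inf le_top hDi : Z.basicOpen h ≤ ⊤ ⊓ Zop ι {i})).op (comp ι G (g j) i) := by
    intro j
    change ((injPow ι m j N ≫ piPow ι G m g N).app _) _ = _
    rw [injPow_piPow ι G m g j N (Nat.lt_succ_iff.mp j.2)]
    exact homOfTwistSection_app_smul_gen ι G m g j hDi _
  simp only [hterm]
  have hunit : (↑(u⁻¹ ^ M) : Γ(Z, Z.basicOpen h)) * Z.presheaf.map (homOfLE (Z.basicOpen_le h)).op h ^ M = 1 := by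
    rw [← hu, Units.val_pow_eq_pow_val, ← mul_pow, Units.inv_mul, one_pow]
  symm
  calc G.presheaf.map (homOfLE hDU).op t
      = ((↑(u⁻¹ ^ M) : Γ(Z, Z.basicOpen h)) * Z.presheaf.map (homOfLE (Z.basicOpen_le h)).op h ^ M) •
          G.presheaf.map (homOfLE hDU).op t := by rw [hunit, one_smul]
    _ = (↑(u⁻¹ ^ M) : Γ(Z, Z.basicOpen h)) • G.presheaf.map (homOfLE hDi).op y := by rw [mul_smul, ← hy]
    _ = _ := by
      rw [← ha, map_sum, Finset.smul_sum]
      refine Finset.sum_congr rfl fun j _ => ?_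
      rw [Scheme.Modules.map_smul, moduleMap_map_apply, smul_smul]

end Sum

/-! ## The package -/

/-- Monotonicity helper: generation by the chart values on `Z_{i}` is the case `s = {i}` of the generation
statement of Serre's theorem A. [folklore] -/
theorem generates_singleton {A : Type u} [CommRing A] {r : ℕ} {Z : Scheme.{u}} (ι : Z ⟶ PP A r) (G : Z.Modules)
    (m N : ℕ) (g : Fin (N + 1) → Γ(twistMod ι G m, ⊤))
    (hgen : ∀ (s : Finset (Fin (r + 1))) (i₀ : Fin (r + 1)) (hi₀ : i₀ ∈ s) (t : Γ(G, Zop ι s)),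
      t ∈ Submodule.span Γ(Z, Zop ι s) (Set.range fun j => G.presheaf.map
        (homOfLE (le_inf le_top (Zop_mono ι (Finset.singleton_subset_iff.mpr hi₀)))).op (comp ι G (g j) i₀)))
    (i : Fin (r + 1)) (t : Γ(G, Zop ι {i})) :
    t ∈ Submodule.span Γ(Z, Zop ι {i}) (Set.range fun j : Fin (N + 1) =>
      G.presheaf.map (homOfLE (le_inf le_top le_rfl : Zop ι {i} ≤ ⊤ ⊓ Zop ι {i})).op (comp ι G (g j) i)) :=
  hgen {i} i (Finset.mem_singleton_self i) t


end SerreTwist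

end Literature.AlgebraicGeometry.Modules

end
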